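import Mathlib
import Literature.Analysis.Calculus.TwoVariablePartials
import Literature.Analysis.PDE.Wave1DFarEnergyLimits
import Summits.FinalStateConjecture.FinalStateConjecture.Theorems.PhotonSphereChannelsUniformPhotonSphereChannelsRKernelOneIdentities
import Summits.FinalStateConjecture.FinalStateConjecture.Theorems.PhotonSphereChannelsUniformPhotonSphereChannelsRKernelOneRayFlux

/-!
# Kernel-one far channels, IV: the wedge inequality

Helper file for `stub_kernelOneChannels` of line `crum-peeling-recessive-tower` (crux
`UniformPhotonSphereChannelsR`, stmt-FinalStateConjecture-14074).  Setting of
`…RKernelOneRayFlux`: `ψ ∈ C²(ℝ²)` solves `ψ_tt − ψ_xx + V(x)ψ = 0` on `{x ≥ x_f}`, `V ≥ 0`, finite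
initial far energy; here moreover `V ∈ C¹(ℝ)` is non-increasing on `[x_f, ∞)`.

* `strip_momentum_identity` — the momentum flux through a vertical half-line (energy identity
  on the strip `{0 ≤ τ ≤ T, x ≥ X}`): `∫_0^T 2ψ_tψ_x(τ, X) dτ = ∫_{x>X} e(0,·) − ∫_{x>X} e(T,·)`.
* `half_wedge_le` — for `T ≥ 0`, `X = x_f + T`: the truncated "sideways" ray flux through `C⁺`
  is controlled by the far energy at time `T`, the initial energy beyond `X` and the initial
  momentum on `[x_f, X]`:
  `∫_{x_f}^{X} [(ψ_t+ψ_x)² − Vψ²](x − x_f, x) dx ≤ E(T) + ∫_{x>X} e(0,·) + ∫_{x_f}^{X} 2ψ_tψ_x(0,·)`.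
  Proof: the momentum identity on the triangle `{0 ≤ t ≤ T, x_f + t ≤ x ≤ X}` expresses the left
  side through the sideways energy `S = ∫_0^T (ψ_x² + ψ_t² − Vψ²)(τ, X) dτ` on the vertical side
  plus a signed bulk `∬ V'ψ² ≤ 0`; the momentum identity on the triangle
  `{0 ≤ τ ≤ T, X ≤ x ≤ X + T − τ}` bounds `S` by the out-flux through the incoming characteristic
  from `(0, X + T)` plus `∫_X^{X+T} |2ψ_tψ_x(0,·)|`; the energy identity on the same triangle and
  the strip identity turn that out-flux into `E_{[X,X+T]}(0) + E(T) − E_{>X}(0)`.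
* `wedge_le` — letting `X → ∞` and adding the time-reversed statement:
  `(A⁺ − B⁺) + (A⁻ − B⁻) ≤ E⁺ + E⁻`, where `A^± = ∫ (ψ_t ± ψ_x)²`, `B^± = ∫ Vψ²` along the rays
  `C^± = {(±(x − x_f), x)}` and `E^± = lim_{t → ±∞} E(t)`.
-/

noncomputable section

-- the doubled `FinalStateConjecture.FinalStateConjecture` path component trips dupNamespace
set_option linter.dupNamespace false

namespace Summit.FinalStateConjecture.FinalStateConjecture.Theorems.CrumPeelingRecessiveTower

open MeasureTheory Set Filter Topology intervalIntegral Literature.Analysis.Calculus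
open Literature.Analysis.PDE

variable {V : ℝ → ℝ} {ψ : ℝ → ℝ → ℝ} {xf : ℝ}

section Strip

variable (hV : Continuous V) (hV0 : ∀ x, 0 ≤ V x) (hψ : ContDiff ℝ 2 (Function.uncurry ψ))
  (hsol : ∀ τ x, xf ≤ x →
    iteratedDeriv 2 (fun σ => ψ σ x) τ - iteratedDeriv 2 (ψ τ) x + V x * ψ τ x = 0)
  (hfin : ∫⁻ x in Ioi xf, ENNReal.ofReal
    (deriv (fun τ => ψ τ x) 0 ^ 2 + deriv (ψ 0) x ^ 2 + V x * ψ 0 x ^ 2) < ⊤)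
include hV hV0 hψ hsol hfin

/-- **Momentum flux through a vertical half-line** (energy identity on the strip
`{0 ≤ τ ≤ T, x ≥ X}`, `X ≥ x_f + T`): `∫_0^T 2ψ_tψ_x(τ, X) dτ = ∫_{x>X} e(0,·) − ∫_{x>X} e(T,·)`. -/
theorem strip_momentum_identity {T X : ℝ} (hT : 0 ≤ T) (hX : xf + T ≤ X) :
    (∫ τ in (0 : ℝ)..T, 2 * (deriv (fun σ => ψ σ X) τ * deriv (ψ τ) X))
      = (∫ x in Ioi X, (deriv (fun τ => ψ τ x) 0 ^ 2 + deriv (ψ 0) x ^ 2 + V x * ψ 0 x ^ 2))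
        - ∫ x in Ioi X, (deriv (fun τ => ψ τ x) T ^ 2 + deriv (ψ T) x ^ 2 + V x * ψ T x ^ 2) := by
  set e0 : ℝ → ℝ := fun x => deriv (fun τ => ψ τ x) 0 ^ 2 + deriv (ψ 0) x ^ 2 + V x * ψ 0 x ^ 2
    with he0
  set eT : ℝ → ℝ := fun x => deriv (fun τ => ψ τ x) T ^ 2 + deriv (ψ T) x ^ 2 + V x * ψ T x ^ 2
    with heT
  set M : ℝ := ∫ τ in (0 : ℝ)..T, 2 * (deriv (fun σ => ψ σ X) τ * deriv (ψ τ) X) with hM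
  set out : ℝ → ℝ := fun b => ∫ x in (b - T)..b,
    ((deriv (fun τ => ψ τ x) (b - x) - deriv (ψ (b - x)) x) ^ 2 + V x * ψ (b - x) x ^ 2) with hout
  have hid : ∀ b, X ≤ b - T →
      (∫ x in X..(b - T), eT x) - (∫ x in X..b, e0 x) + out b = -M := by
    intro b hb
    have h := vtrap_energy_identity hV hψ hsol (A := X) (b := b) (s := 0) (t := T) hT hb
      (by linarith)
    simp only [sub_zero] at h
    exact h
  have hintT : IntegrableOn eT (Ioi X) :=
    (integrableOn_energy hV hV0 hψ hsol hfin hT).mono_set (Ioi_subset_Ioi hX)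
  have hint0 : IntegrableOn e0 (Ioi X) :=
    (integrableOn_energy_zero hV hV0 hψ hsol hfin).mono_set (Ioi_subset_Ioi (by linarith))
  have hF1 : Tendsto (fun b => ∫ x in X..(b - T), eT x) atTop (𝓝 (∫ x in Ioi X, eT x)) :=
    intervalIntegral_tendsto_integral_Ioi X hintT (tendsto_atTop_add_const_right _ _ tendsto_id)
  have hF2 : Tendsto (fun b => ∫ x in X..b, e0 x) atTop (𝓝 (∫ x in Ioi X, e0 x)) :=
    intervalIntegral_tendsto_integral_Ioi X hint0 tendsto_id
  have hF3 := tendsto_outflux hV hV0 hψ hsol hfin hT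
  have hlim : Tendsto (fun b => (∫ x in X..(b - T), eT x) - (∫ x in X..b, e0 x) + out b) atTop
      (𝓝 (-M)) := by
    refine tendsto_const_nhds.congr' ?_
    filter_upwards [eventually_ge_atTop (X + T)] with b hb
    exact (hid b (by linarith)).symm
  have huniq := tendsto_nhds_unique ((hF1.sub hF2).add hF3) hlim
  linarith

end Strip

/-- A `C¹` function that is non-increasing on `[x_f, ∞)` has derivative `≤ 0` there (including at
the endpoint). -/
theorem deriv_nonpos_of_antitoneOn (hV : ContDiff ℝ 1 V) (hVa : AntitoneOn V (Ici xf)) {x : ℝ}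
    (hx : xf ≤ x) : deriv V x ≤ 0 := by
  rw [← ((hV.differentiable (by norm_num)) x).derivWithin (uniqueDiffOn_Ici xf x hx)]
  exact hVa.derivWithin_nonpos

/-- The signed bulk term: `∫_0^T ∫_{lo(τ)}^{hi(τ)} V'(x)ψ(τ,x)² dx dτ ≤ 0` whenever `V' ≤ 0` on
`[x_f, ∞)` and `x_f ≤ lo(τ) ≤ hi(τ)` for `τ ∈ [0, T]`. -/
theorem bulk_nonpos (hV : ContDiff ℝ 1 V) (hVa : AntitoneOn V (Ici xf)) {T : ℝ} (hT : 0 ≤ T)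
    {lo hi : ℝ → ℝ} (hlo : ∀ τ ∈ Icc 0 T, xf ≤ lo τ) (hlh : ∀ τ ∈ Icc 0 T, lo τ ≤ hi τ) :
    (∫ τ in (0 : ℝ)..T, ∫ x in (lo τ)..(hi τ), deriv V x * ψ τ x ^ 2) ≤ 0 := by
  have h : 0 ≤ ∫ τ in (0 : ℝ)..T, -∫ x in (lo τ)..(hi τ), deriv V x * ψ τ x ^ 2 := by
    refine intervalIntegral.integral_nonneg hT fun τ hτ => ?_
    rw [← intervalIntegral.integral_neg]
    refine intervalIntegral.integral_nonneg (hlh τ hτ) fun x hx => ?_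
    have := deriv_nonpos_of_antitoneOn hV hVa ((hlo τ hτ).trans hx.1)
    nlinarith [sq_nonneg (ψ τ x)]
  rw [intervalIntegral.integral_neg] at h
  linarith

/-- **Time reversal on the half-plane.** If `ψ ∈ C²` solves the equation on `{x ≥ x_f}` then so
does `ψr(t, x) = ψ(−t, x)`; its energy density at `(t, x)` is that of `ψ` at `(−t, x)`, its data at
`t = 0` are `(ψ(0,·), −ψ_t(0,·))`. -/
theorem timeReversal_halfPlane (hψ : ContDiff ℝ 2 (Function.uncurry ψ))
    (hsol : ∀ τ x, xf ≤ x →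
      iteratedDeriv 2 (fun σ => ψ σ x) τ - iteratedDeriv 2 (ψ τ) x + V x * ψ τ x = 0)
    {ψr : ℝ → ℝ → ℝ} (hψr : ψr = fun t x => ψ (-t) x) :
    ContDiff ℝ 2 (Function.uncurry ψr) ∧
    (∀ τ x, xf ≤ x →
      iteratedDeriv 2 (fun σ => ψr σ x) τ - iteratedDeriv 2 (ψr τ) x + V x * ψr τ x = 0) ∧
    (∀ t x, deriv (fun τ => ψr τ x) t ^ 2 + deriv (ψr t) x ^ 2 + V x * ψr t x ^ 2
      = deriv (fun τ => ψ τ x) (-t) ^ 2 + deriv (ψ (-t)) x ^ 2 + V x * ψ (-t) x ^ 2) ∧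
    ψr 0 = ψ 0 ∧ (∀ x, deriv (fun σ => ψr σ x) 0 = -deriv (fun σ => ψ σ x) 0) := by
  obtain ⟨hψrC, hsolr', her⟩ := wave1D_timeReversal_source hψ (V := V)
    (F := fun t x => iteratedDeriv 2 (fun τ => ψ τ x) t - iteratedDeriv 2 (ψ t) x + V x * ψ t x)
    (fun t x => rfl)
  rw [← hψr] at hψrC hsolr' her
  have hslice : ∀ t, ψr t = ψ (-t) := fun t => by funext y; simp [hψr]
  refine ⟨hψrC, fun τ x hx => ?_, fun t x => ?_, by rw [hslice, neg_zero], fun x => ?_⟩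
  · rw [hsolr' τ x]; exact hsol (-τ) x hx
  · rw [her t x, hslice]
  · have : (fun σ => ψr σ x) = fun σ => (fun τ => ψ τ x) (-σ) := by funext σ; simp [hψr]
    rw [this, deriv_comp_neg (fun τ => ψ τ x) 0, neg_zero]

section HalfPlane

variable (hV : ContDiff ℝ 1 V) (hV0 : ∀ x, 0 ≤ V x) (hVa : AntitoneOn V (Ici xf))
  (hψ : ContDiff ℝ 2 (Function.uncurry ψ))
  (hsol : ∀ τ x, xf ≤ x →
    iteratedDeriv 2 (fun σ => ψ σ x) τ - iteratedDeriv 2 (ψ τ) x + V x * ψ τ x = 0)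
  (hfin : ∫⁻ x in Ioi xf, ENNReal.ofReal
    (deriv (fun τ => ψ τ x) 0 ^ 2 + deriv (ψ 0) x ^ 2 + V x * ψ 0 x ^ 2) < ⊤)
include hV hV0 hVa hψ hsol hfin

/-- **Half wedge inequality** (see the module docstring): for `T ≥ 0`,
`∫_{x_f}^{x_f+T} [(ψ_t+ψ_x)² − Vψ²](x − x_f, x) dx ≤ E(T) + ∫_{x > x_f+T} e(0,·) + ∫_{x_f}^{x_f+T} 2ψ_t(0,x)ψ_x(0,x) dx`. -/
theorem half_wedge_le {T : ℝ} (hT : 0 ≤ T) :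
    (∫ x in xf..(xf + T), ((deriv (fun τ => ψ τ x) (x - xf) + deriv (ψ (x - xf)) x) ^ 2
        - V x * ψ (x - xf) x ^ 2))
      ≤ (∫ x in Ioi (xf + T), (deriv (fun τ => ψ τ x) T ^ 2 + deriv (ψ T) x ^ 2 + V x * ψ T x ^ 2))
        + (∫ x in Ioi (xf + T), (deriv (fun τ => ψ τ x) 0 ^ 2 + deriv (ψ 0) x ^ 2 + V x * ψ 0 x ^ 2))
        + ∫ x in xf..(xf + T), 2 * (deriv (fun σ => ψ σ x) 0 * deriv (ψ 0) x) := by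
  have hVc : Continuous V := hV.continuous
  set X : ℝ := xf + T with hX
  set e0 : ℝ → ℝ := fun x => deriv (fun τ => ψ τ x) 0 ^ 2 + deriv (ψ 0) x ^ 2 + V x * ψ 0 x ^ 2
    with he0
  set eT : ℝ → ℝ := fun x => deriv (fun τ => ψ τ x) T ^ 2 + deriv (ψ T) x ^ 2 + V x * ψ T x ^ 2
    with heT
  set m0 : ℝ → ℝ := fun x => 2 * (deriv (fun σ => ψ σ x) 0 * deriv (ψ 0) x) with hm0
  -- (i) momentum identity on the triangle `{0 ≤ t ≤ T, xf + t ≤ x ≤ X}`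
  have hM2 := ctrap_momentum_identity hV hψ hsol (a := xf) (B := X) (s := 0) (t := T) hT
    (le_of_eq hX.symm) (by simp)
  have htop2 : (∫ x in (xf + T)..X, 2 * (deriv (fun σ => ψ σ x) T * deriv (ψ T) x)) = 0 := by
    rw [hX, intervalIntegral.integral_same]
  rw [htop2, zero_add, add_zero] at hM2
  have hbulkU := bulk_nonpos (ψ := ψ) hV hVa hT (lo := fun τ => xf + τ) (hi := fun _ => X)
    (fun τ hτ => show xf ≤ xf + τ by linarith [hτ.1])
    (fun τ hτ => show xf + τ ≤ X by rw [hX]; linarith [hτ.2])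
  -- (ii) momentum identity on the triangle `{0 ≤ τ ≤ T, X ≤ x ≤ X + T - τ}`
  have hM1 := vtrap_momentum_identity hV hψ hsol (A := X) (b := X + T) (s := 0) (t := T) hT
    (by linarith) (by simp [hX, hT])
  have htop1 : (∫ x in X..(X + T - T), 2 * (deriv (fun σ => ψ σ x) T * deriv (ψ T) x)) = 0 := by
    rw [show X + T - T = X by ring, intervalIntegral.integral_same]
  rw [htop1, neg_zero, zero_add, sub_zero, show X + T - T = X by ring] at hM1
  have hbulkW := bulk_nonpos (ψ := ψ) hV hVa hT (lo := fun _ => X) (hi := fun τ => X + T - τ)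
    (fun τ _ => show xf ≤ X by rw [hX]; linarith) (fun τ hτ => show X ≤ X + T - τ by linarith [hτ.2])
  -- (iii) energy identity on the same triangle and the strip identity
  have hE1 := vtrap_energy_identity hVc hψ hsol (A := X) (b := X + T) (s := 0) (t := T) hT
    (by linarith) (by simp [hX, hT])
  have htopE : (∫ x in X..(X + T - T), eT x) = 0 := by
    rw [show X + T - T = X by ring, intervalIntegral.integral_same]
  rw [show (∫ x in X..(X + T - T), (deriv (fun τ => ψ τ x) T ^ 2 + deriv (ψ T) x ^ 2
    + V x * ψ T x ^ 2)) = 0 from htopE, zero_sub, sub_zero, show X + T - T = X by ring] at hE1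
  have hS := strip_momentum_identity hVc hV0 hψ hsol hfin hT (X := X) le_rfl
  -- (iv) elementary bounds
  have hint0 : IntegrableOn e0 (Ioi X) :=
    (integrableOn_energy_zero hVc hV0 hψ hsol hfin).mono_set (Ioi_subset_Ioi (by simp [hX, hT]))
  have he0c : Continuous e0 :=
    (continuous_wave1D_energyDensity hVc hψ).comp (continuous_const.prodMk continuous_id)
  have he0nn : ∀ x, 0 ≤ e0 x := fun x => wave1D_energyDensity_nonneg hV0 0 x
  have hEseg_le : (∫ x in X..(X + T), e0 x) ≤ ∫ x in Ioi X, e0 x := by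
    rw [intervalIntegral.integral_of_le (by linarith)]
    exact setIntegral_mono_set hint0 (ae_of_all _ he0nn) (ae_of_all _ Ioc_subset_Ioi_self)
  have hm0_le : (∫ x in X..(X + T), m0 x) ≤ ∫ x in X..(X + T), e0 x := by
    refine intervalIntegral.integral_mono_on (by linarith) ?_ (he0c.intervalIntegrable _ _)
      fun x _ => ?_
    · obtain ⟨ψt, ψx, -, -, -, hct, hcx, -, -, -, h1, h2, -⟩ := exists_partials_of_contDiff_two hψ
      have : m0 = fun x => 2 * (ψt 0 x * ψx 0 x) := by
        funext x; simp only [hm0, (h1 0 x).deriv, (h2 0 x).deriv]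
      rw [this]
      exact ((hct.comp (continuous_const.prodMk continuous_id)).mul
        (hcx.comp (continuous_const.prodMk continuous_id))).const_mul 2 |>.intervalIntegrable _ _
    · simp only [hm0, he0]
      have := hV0 x
      nlinarith [sq_nonneg (deriv (fun σ => ψ σ x) 0 - deriv (ψ 0) x), sq_nonneg (ψ 0 x)]
  have hchar_le : (∫ x in X..(X + T), ((deriv (fun τ => ψ τ x) (X + T - x)
      - deriv (ψ (X + T - x)) x) ^ 2 - V x * ψ (X + T - x) x ^ 2))
      ≤ ∫ x in X..(X + T), ((deriv (fun τ => ψ τ x) (X + T - x)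
        - deriv (ψ (X + T - x)) x) ^ 2 + V x * ψ (X + T - x) x ^ 2) := by
    obtain ⟨ψt, ψx, -, -, -, hct, hcx, -, -, -, h1, h2, -⟩ := exists_partials_of_contDiff_two hψ
    have hd1 : ∀ t x, deriv (fun τ => ψ τ x) t = ψt t x := fun t x => (h1 t x).deriv
    have hd2 : ∀ t x, deriv (ψ t) x = ψx t x := fun t x => (h2 t x).deriv
    simp only [hd1, hd2]
    have hray : Continuous fun x : ℝ => ((X + T - x, x) : ℝ × ℝ) :=
      (continuous_const.sub continuous_id).prodMk continuous_id
    have c1 : Continuous fun x => (ψt (X + T - x) x - ψx (X + T - x) x) ^ 2 :=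
      ((hct.comp hray).sub (hcx.comp hray)).pow 2
    have c2 : Continuous fun x => V x * ψ (X + T - x) x ^ 2 :=
      hVc.mul ((hψ.continuous.comp hray).pow 2)
    refine intervalIntegral.integral_mono_on (by linarith) ((c1.sub c2).intervalIntegrable _ _)
      ((c1.add c2).intervalIntegrable _ _) fun x _ => ?_
    have := hV0 x
    nlinarith [sq_nonneg (ψ (X + T - x) x)]
  have hEseg0 : 0 ≤ ∫ x in X..(X + T), e0 x :=
    intervalIntegral.integral_nonneg (by linarith) fun x _ => he0nn x
  -- conclude
  simp only [he0, heT, hm0] at *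
  linarith

omit hVa in
/-- Tails of the initial far energy vanish: `∫_{x > x_f + T} e(0,·) → 0` as `T → ∞`. -/
theorem tendsto_tail_energy_zero :
    Tendsto (fun T => ∫ x in Ioi (xf + T),
      (deriv (fun τ => ψ τ x) 0 ^ 2 + deriv (ψ 0) x ^ 2 + V x * ψ 0 x ^ 2)) atTop (𝓝 0) := by
  have hint := integrableOn_energy_zero hV.continuous hV0 hψ hsol hfin
  have hanti : Antitone fun T : ℝ => Ioi (xf + T) := fun a b hab => Ioi_subset_Ioi (by linarith)
  have h := tendsto_setIntegral_of_antitone (μ := volume)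
    (f := fun x => deriv (fun τ => ψ τ x) 0 ^ 2 + deriv (ψ 0) x ^ 2 + V x * ψ 0 x ^ 2)
    (fun T => measurableSet_Ioi) hanti ⟨0, by simpa using hint⟩
  have hempty : (⋂ T : ℝ, Ioi (xf + T)) = ∅ := by
    ext x
    simp only [mem_iInter, mem_Ioi, mem_empty_iff_false, iff_false, not_forall, not_lt]
    exact ⟨x - xf, by linarith⟩
  rw [hempty, Measure.restrict_empty, integral_zero_measure] at h
  exact h

/-- **The wedge inequality.** With `ψr(t, x) = ψ(−t, x)` the time-reversed solution and
`E^± = lim_{t → ±∞} ∫_{x > x_f + |t|} e(t,·)` the far channel energies: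
`(A⁺ − B⁺) + (A⁻ − B⁻) ≤ E⁺ + E⁻`, where `A⁺ = ∫_{x_f}^∞ (ψ_t+ψ_x)²(x − x_f, x) dx`,
`B⁺ = ∫_{x_f}^∞ V(x)ψ(x − x_f, x)² dx` are the kinetic and potential fluxes through the outgoing
ray `C⁺` and `A⁻, B⁻` the same quantities for `ψr` (i.e. through `C⁻`). -/
theorem wedge_le {ψr : ℝ → ℝ → ℝ} (hψr : ψr = fun t x => ψ (-t) x) {Lp Lm : ℝ}
    (hLp : Tendsto (fun t => ∫ x in Ioi (xf + |t|),
      (deriv (fun τ => ψ τ x) t ^ 2 + deriv (ψ t) x ^ 2 + V x * ψ t x ^ 2)) atTop (𝓝 Lp))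
    (hLm : Tendsto (fun t => ∫ x in Ioi (xf + |t|),
      (deriv (fun τ => ψ τ x) t ^ 2 + deriv (ψ t) x ^ 2 + V x * ψ t x ^ 2)) atBot (𝓝 Lm)) :
    ((∫ x in Ioi xf, (deriv (fun τ => ψ τ x) (x - xf) + deriv (ψ (x - xf)) x) ^ 2)
        - ∫ x in Ioi xf, V x * ψ (x - xf) x ^ 2)
      + ((∫ x in Ioi xf, (deriv (fun τ => ψr τ x) (x - xf) + deriv (ψr (x - xf)) x) ^ 2)
        - ∫ x in Ioi xf, V x * ψr (x - xf) x ^ 2)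
      ≤ Lp + Lm := by
  have hVc : Continuous V := hV.continuous
  -- the time-reversed solution
  obtain ⟨hψrC, hsolr, hert, hψr0', hdr0⟩ := timeReversal_halfPlane hψ hsol hψr
  have her0 : ∀ x, deriv (fun τ => ψr τ x) 0 ^ 2 + deriv (ψr 0) x ^ 2 + V x * ψr 0 x ^ 2
      = deriv (fun τ => ψ τ x) 0 ^ 2 + deriv (ψ 0) x ^ 2 + V x * ψ 0 x ^ 2 := by
    intro x
    rw [hert 0 x, neg_zero]
  have hfinr : ∫⁻ x in Ioi xf, ENNReal.ofReal
      (deriv (fun τ => ψr τ x) 0 ^ 2 + deriv (ψr 0) x ^ 2 + V x * ψr 0 x ^ 2) < ⊤ := by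
    simp only [her0]; exact hfin
  have hLpr : Tendsto (fun t => ∫ x in Ioi (xf + |t|),
      (deriv (fun τ => ψr τ x) t ^ 2 + deriv (ψr t) x ^ 2 + V x * ψr t x ^ 2)) atTop (𝓝 Lm) := by
    refine (hLm.comp tendsto_neg_atTop_atBot).congr fun t => ?_
    simp only [Function.comp, hert, abs_neg]
  -- truncated inequalities for `ψ` and `ψr`
  have hW := fun T (hT : 0 ≤ T) => half_wedge_le hV hV0 hVa hψ hsol hfin hT
  have hWr := fun T (hT : 0 ≤ T) => half_wedge_le hV hV0 hVa hψrC hsolr hfinr hT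
  -- the initial momenta cancel
  have hm0 : ∀ T, (∫ x in xf..(xf + T), 2 * (deriv (fun σ => ψr σ x) 0 * deriv (ψr 0) x))
      = -∫ x in xf..(xf + T), 2 * (deriv (fun σ => ψ σ x) 0 * deriv (ψ 0) x) := by
    intro T
    rw [← intervalIntegral.integral_neg]
    refine integral_congr fun x _ => ?_
    rw [hdr0 x, hψr0']
    ring
  -- integrability of the ray densities
  obtain ⟨hiA, hiB, -⟩ := ray_flux_integrableOn hVc hV0 hψ hsol hfin hLp
  obtain ⟨hiAr, hiBr, -⟩ := ray_flux_integrableOn hVc hV0 hψrC hsolr hfinr hLpr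
  -- limits of the left-hand sides
  have hL : Tendsto (fun T => ∫ x in xf..(xf + T),
      ((deriv (fun τ => ψ τ x) (x - xf) + deriv (ψ (x - xf)) x) ^ 2 - V x * ψ (x - xf) x ^ 2))
      atTop (𝓝 ((∫ x in Ioi xf, (deriv (fun τ => ψ τ x) (x - xf) + deriv (ψ (x - xf)) x) ^ 2)
        - ∫ x in Ioi xf, V x * ψ (x - xf) x ^ 2)) := by
    rw [← integral_sub hiA hiB]
    exact intervalIntegral_tendsto_integral_Ioi xf (hiA.sub hiB)
      (tendsto_atTop_add_const_left _ _ tendsto_id)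
  have hLr : Tendsto (fun T => ∫ x in xf..(xf + T),
      ((deriv (fun τ => ψr τ x) (x - xf) + deriv (ψr (x - xf)) x) ^ 2 - V x * ψr (x - xf) x ^ 2))
      atTop (𝓝 ((∫ x in Ioi xf, (deriv (fun τ => ψr τ x) (x - xf) + deriv (ψr (x - xf)) x) ^ 2)
        - ∫ x in Ioi xf, V x * ψr (x - xf) x ^ 2)) := by
    rw [← integral_sub hiAr hiBr]
    exact intervalIntegral_tendsto_integral_Ioi xf (hiAr.sub hiBr)
      (tendsto_atTop_add_const_left _ _ tendsto_id)
  -- limits of the right-hand sides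
  have hE : Tendsto (fun T => ∫ x in Ioi (xf + T),
      (deriv (fun τ => ψ τ x) T ^ 2 + deriv (ψ T) x ^ 2 + V x * ψ T x ^ 2)) atTop (𝓝 Lp) := by
    refine hLp.congr' ?_
    filter_upwards [eventually_ge_atTop 0] with t ht
    rw [abs_of_nonneg ht]
  have hEr : Tendsto (fun T => ∫ x in Ioi (xf + T),
      (deriv (fun τ => ψr τ x) T ^ 2 + deriv (ψr T) x ^ 2 + V x * ψr T x ^ 2)) atTop (𝓝 Lm) := by
    refine hLpr.congr' ?_
    filter_upwards [eventually_ge_atTop 0] with t ht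
    rw [abs_of_nonneg ht]
  have ht0 := tendsto_tail_energy_zero hV hV0 hψ hsol hfin
  have ht0r := tendsto_tail_energy_zero hV hV0 hψrC hsolr hfinr
  have hR := ((hE.add hEr).add (ht0.add ht0r))
  rw [add_zero, add_zero] at hR
  refine le_of_tendsto_of_tendsto (hL.add hLr) hR ?_
  filter_upwards [eventually_ge_atTop 0] with T hT
  have h1 := hW T hT
  have h2 := hWr T hT
  rw [hm0 T] at h2
  linarith

end HalfPlane

/-- Registered form of `wedge_le` (sub-goal `stub_kernelOneWedge` of the crux item). -/
theorem stub_kernelOneWedge : ∀ (V : ℝ → ℝ) (ψ : ℝ → ℝ → ℝ) (xf : ℝ), ContDiff ℝ 1 V →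
    (∀ x, 0 ≤ V x) → AntitoneOn V (Set.Ici xf) → ContDiff ℝ 2 (Function.uncurry ψ) →
    (∀ τ x, xf ≤ x →
      iteratedDeriv 2 (fun σ => ψ σ x) τ - iteratedDeriv 2 (ψ τ) x + V x * ψ τ x = 0) →
    (∫⁻ x in Set.Ioi xf, ENNReal.ofReal
      (deriv (fun τ => ψ τ x) 0 ^ 2 + deriv (ψ 0) x ^ 2 + V x * ψ 0 x ^ 2)) < ⊤ →
    ∀ (ψr : ℝ → ℝ → ℝ), (ψr = fun t x => ψ (-t) x) → ∀ (Lp Lm : ℝ),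
    Filter.Tendsto (fun t => ∫ x in Set.Ioi (xf + |t|),
      (deriv (fun τ => ψ τ x) t ^ 2 + deriv (ψ t) x ^ 2 + V x * ψ t x ^ 2)) Filter.atTop (nhds Lp) →
    Filter.Tendsto (fun t => ∫ x in Set.Ioi (xf + |t|),
      (deriv (fun τ => ψ τ x) t ^ 2 + deriv (ψ t) x ^ 2 + V x * ψ t x ^ 2)) Filter.atBot (nhds Lm) →
    ((∫ x in Set.Ioi xf, (deriv (fun τ => ψ τ x) (x - xf) + deriv (ψ (x - xf)) x) ^ 2)
        - ∫ x in Set.Ioi xf, V x * ψ (x - xf) x ^ 2)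
      + ((∫ x in Set.Ioi xf, (deriv (fun τ => ψr τ x) (x - xf) + deriv (ψr (x - xf)) x) ^ 2)
        - ∫ x in Set.Ioi xf, V x * ψr (x - xf) x ^ 2) ≤ Lp + Lm :=
  fun _ _ _ hV hV0 hVa hψ hsol hfin _ hψr _ _ hLp hLm =>
    wedge_le hV hV0 hVa hψ hsol hfin hψr hLp hLm

end Summit.FinalStateConjecture.FinalStateConjecture.Theorems.CrumPeelingRecessiveTower
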